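import Summits.QuantumFields.BalabanUV.Beta.AccretiveCombesThomas
import Literature.MathematicalPhysics.QuantumFieldTheory.Balaban1983to89.B5Prop11Lower
import Literature.MathematicalPhysics.QuantumFieldTheory.Balaban1983to89.QGQInverse
import HarnessLib

/-!
# N15 (NE2) King-model rung, PART 28a — RE-COERCIVE COMPLEX MATRICES AND HOLOMORPHIC MATRIX INVERSES
# (the vocabulary for [B9] Theorem 3.4 «the operators extend … as ANALYTIC functions» in King's A = 0 model)

Tenth generation (g10) of the seat `pub-ymgap-dag-n15-d` (R134, node N15 = NE2, strategy s3 = King-model rung), part 28 of the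
lineage `Summit.QuantumFields.YangMills.BalabanUVNodes.N15.KingModel` (parts 1–27: King's A = 0 scalar block-spin tower, its
potential dressing, the NE2 layers by name, the tightness edition).  The g7 HANDOFF left ONE door open, verbatim: «COMPLEX couplings ∕
genuine holomorphy of `t ↦ C_{tv}` (the Spine's `differentiableOn_pertLim` is complex-analytic): 9e∕9f are REAL-variable C¹ statements;
a complex extension needs coercivity → sectoriality of `A₀ + z·diag w` for complex `z`, not in the tree's real `Coercive` vocabulary».
This file supplies that vocabulary, GENERIC over a finite index type with complex entries, in the HYPOTHESIS-SHAPE style of the tree's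
`Beta.AccretiveCombesThomas` (no `Prop`-valued definition: «`S` is `Re`-coercive with `γ`» = `∀ x, γ·nsq x ≤ Re⟨x̄, Sx⟩`, with
`B5Prop11Lower.nsq x = Σ‖x_i‖²`; Cauchy–Schwarz `B5Prop11Lower.norm_star_dotProduct_le` and `AccretiveCombesThomas.isUnit_of_reCoercive` BY NAME):

* §1 a REAL coercive matrix (`QGQInverse.Coercive A γ`) is `Re`-coercive over ℂ with the SAME constant (`reCoercive_map_ofReal`, no symmetry
  needed), the Hermitian form of a complex multiple of a bounded real diagonal (`norm_form_smul_diagonal_le`, `‖z‖·w₀·nsq`), stability of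
  `Re`-coercivity under form-small perturbations (`reCoercive_add_of_norm_form_le`), the resolvent bound `‖S⁻¹u‖₂ ≤ γ⁻¹‖u‖₂`
  (`sqrt_nsq_inv_mulVec_le`, Lax–Milgram), the entry bound `‖S⁻¹ i j‖ ≤ γ⁻¹` (`inv_entry_norm_le_of_reCoercive`, complex twin of
  `QGQInverse.inv_entry_le_of_coercive`), the sandwich bound `‖⟨ȳ, S⁻¹u⟩‖ ≤ γ⁻¹‖y‖₂‖u‖₂`, `‖(z·diag w)v‖₂ ≤ ‖z‖w₀‖v‖₂` (the second
  resolvent identity is the tree's `UnitaryCayley.inv_sub_inv_eq`);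
* §2 HOLOMORPHIC MATRIX FAMILIES: for `M : ℂ → Matrix n n ℂ` entrywise ℂ-differentiable at `z₀`, `det (M z)`, every adjugate entry and —
  when `M z₀` is invertible — every entry of `(M z)⁻¹` is ℂ-differentiable at `z₀` (`differentiableAt_inv_apply_of_entries`; the tree's
  `Literature.Analysis.Matrix.LogDetDerivative.differentiableAt_inv_apply` is the REAL-parameter version of the same Cramer-rule argument);
* §3 reading real matrices over ℂ: `map_ofReal_inv` (`(A.map ofReal)⁻¹ = A⁻¹.map ofReal`), `map_ofReal_mul ∕ _add ∕ _sub ∕ _smul`,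
  `affine_map_ofReal`.

Part 28b applies this to King's fine-lattice operator `A₀ + z·diag w`, the effective Laplacian `Δ^{(k)}_{z·w}` and the dressed covariances
`(Δ^{(k)}_{z·w} + aL⁻²Q*Q)⁻¹` at COMPLEX coupling `z`.

PRINTED ANCHOR (template only). T. Bałaban, *Propagators for lattice gauge theories in a background field*, Commun. Math. Phys. **99**
(1985) 389–434 [Balaban1985BackgroundPropagators] (= [B9]), Theorem 3.4 p. 400: «There exists a positive constant a₁ such that the operators
G(U), (Q′(U)G′²(U)Q′*(U))⁻¹, R(U), … extend to configurations U′U for α₁ ≤ a₁ as analytic functions of A. The extended operators satisfy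
all the inequalities of Theorems 3.1–3.3 correspondingly», proved through the Neumann series ∕ second resolvent identity (3.64)–(3.65)
p. 402.  C. King, *The U(1) Higgs model. I. The continuum limit*, Commun. Math. Phys. **102** (1986) 649–677 [King1986] is the model.

HONEST SCOPE.  Elementary finite-dimensional linear algebra and one-variable complex differentiability over Mathlib; nothing here is
specific to King or Bałaban; no decay statement (the accretive Combes–Thomas DECAY is the tree's `Beta.AccretiveCombesThomas`, not used
here); NOT Bałaban's complexified gauge fields `U′U = e^{iηA}U`; NOT a node discharge; count-neutral (helper lemmas `--supports` the K3 crux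
item, never closing it).  No `sorry`, standard axioms.
-/

noncomputable section

open scoped BigOperators Matrix ComplexConjugate
open Finset

namespace Summit.QuantumFields.YangMills.BalabanUVNodes.N15.KingModel

open Literature.MathematicalPhysics.QuantumFieldTheory.Balaban1983to89.QGQInverse (Coercive)
open Literature.MathematicalPhysics.QuantumFieldTheory.Balaban1983to89.B5Prop11Lower (nsq nsq_nonneg star_dotProduct_self
  norm_star_dotProduct_le)
open Summit.QuantumFields.BalabanUV.Beta.AccretiveCombesThomas (isUnit_of_reCoercive nsq_single)

variable {n : Type*} [Fintype n] [DecidableEq n]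

/-! ## §1 `Re`-coercive complex matrices: real matrices read over ℂ, diagonal perturbations, resolvent and entry bounds -/

omit [DecidableEq n] in
/-- `‖x_i‖ ≤ √(nsq x)`. [folklore] -/
theorem norm_le_sqrt_nsq (x : n → ℂ) (i : n) : ‖x i‖ ≤ Real.sqrt (nsq x) :=
  Real.le_sqrt_of_sq_le (single_le_sum (f := fun k => ‖x k‖ ^ 2) (fun _ _ => sq_nonneg _) (mem_univ i))

omit [DecidableEq n] in
/-- `√(nsq x)·√(nsq x) = nsq x`. [folklore] -/
theorem sqrt_nsq_mul_self (x : n → ℂ) : Real.sqrt (nsq x) * Real.sqrt (nsq x) = nsq x :=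
  Real.mul_self_sqrt (nsq_nonneg x)

omit [DecidableEq n] in
/-- `nsq (−x) = nsq x`. [folklore] -/
theorem nsq_neg (x : n → ℂ) : nsq (-x) = nsq x := by
  simp only [nsq, Pi.neg_apply, norm_neg]

omit [DecidableEq n] in
/-- `nsq x = ⟨u, u⟩ + ⟨v, v⟩` for `x = u + iv` (real and imaginary parts). [folklore] -/
theorem nsq_eq_re_add_im (x : n → ℂ) :
    nsq x = (fun i => (x i).re) ⬝ᵥ (fun i => (x i).re) + (fun i => (x i).im) ⬝ᵥ (fun i => (x i).im) := by
  simp only [nsq, dotProduct, ← sum_add_distrib]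
  exact sum_congr rfl fun i _ => by rw [Complex.sq_norm, Complex.normSq_apply]

omit [DecidableEq n] in
/-- **The real part of the Hermitian form of a REAL matrix** splits over real and imaginary parts:
`Re⟨x̄, Ax⟩ = ⟨u, Au⟩ + ⟨v, Av⟩` for `x = u + iv` (no symmetry of `A` needed). [folklore] -/
theorem re_form_map_ofReal (A : Matrix n n ℝ) (x : n → ℂ) :
    (star x ⬝ᵥ (A.map Complex.ofReal) *ᵥ x).re
      = (fun i => (x i).re) ⬝ᵥ A *ᵥ (fun i => (x i).re) + (fun i => (x i).im) ⬝ᵥ A *ᵥ (fun i => (x i).im) := by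
  simp only [dotProduct, Matrix.mulVec, Matrix.map_apply, Pi.star_apply, Complex.star_def, Complex.re_sum, Complex.mul_re,
    Complex.conj_re, Complex.conj_im, Complex.ofReal_re, Complex.ofReal_im, Complex.im_sum, Complex.mul_im, zero_mul, sub_zero,
    add_zero, ← sum_add_distrib]
  refine sum_congr rfl fun i _ => ?_
  simp only [neg_mul, sub_neg_eq_add]

omit [DecidableEq n] in
/-- **A real coercive matrix is `Re`-coercive over ℂ with the same constant**: `Coercive A γ ⇒ ∀ x, γ·nsq x ≤ Re⟨x̄, (A.map ofReal)x⟩`.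
[folklore] -/
theorem reCoercive_map_ofReal {A : Matrix n n ℝ} {γ : ℝ} (h : Coercive A γ) (x : n → ℂ) :
    γ * nsq x ≤ (star x ⬝ᵥ (A.map Complex.ofReal) *ᵥ x).re := by
  rw [re_form_map_ofReal, nsq_eq_re_add_im, mul_add]
  exact add_le_add (h _) (h _)

/-- The Hermitian form of a complex multiple of a real diagonal: `⟨x̄, (z·diag w)x⟩ = z·Σ_i w_i‖x_i‖²`. [folklore] -/
theorem form_smul_diagonal (z : ℂ) (w : n → ℝ) (x : n → ℂ) :
    star x ⬝ᵥ (z • Matrix.diagonal (fun i => (w i : ℂ))) *ᵥ x = z * ∑ i, (w i : ℂ) * (‖x i‖ ^ 2 : ℝ) := by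
  rw [Matrix.smul_mulVec, dotProduct_smul, smul_eq_mul]
  congr 1
  simp only [dotProduct, Matrix.mulVec_diagonal, Pi.star_apply, Complex.star_def]
  exact sum_congr rfl fun i _ => by
    rw [Complex.ofReal_pow, ← Complex.conj_mul']
    ring

/-- **Form bound of a complex multiple of a bounded real diagonal**: `‖⟨x̄, (z·diag w)x⟩‖ ≤ ‖z‖·w₀·nsq x` when `|w_i| ≤ w₀`. [folklore] -/
theorem norm_form_smul_diagonal_le {w : n → ℝ} {w₀ : ℝ} (hw : ∀ i, |w i| ≤ w₀) (z : ℂ) (x : n → ℂ) :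
    ‖star x ⬝ᵥ (z • Matrix.diagonal (fun i => (w i : ℂ))) *ᵥ x‖ ≤ ‖z‖ * w₀ * nsq x := by
  rw [form_smul_diagonal, norm_mul, mul_assoc]
  refine mul_le_mul_of_nonneg_left ?_ (norm_nonneg z)
  calc ‖∑ i, (w i : ℂ) * ((‖x i‖ ^ 2 : ℝ) : ℂ)‖ ≤ ∑ i, ‖(w i : ℂ) * ((‖x i‖ ^ 2 : ℝ) : ℂ)‖ := norm_sum_le _ _
    _ ≤ ∑ i, w₀ * ‖x i‖ ^ 2 := sum_le_sum fun i _ => by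
        rw [norm_mul, Complex.norm_real, Complex.norm_real, Real.norm_eq_abs, Real.norm_eq_abs, abs_of_nonneg (sq_nonneg ‖x i‖)]
        exact mul_le_mul_of_nonneg_right (hw i) (sq_nonneg _)
    _ = w₀ * nsq x := by rw [nsq, mul_sum]

omit [DecidableEq n] in
/-- **`Re`-coercivity is stable under form-small perturbations**: `γ·nsq ≤ Re⟨x̄, Sx⟩` and `‖⟨x̄, Px⟩‖ ≤ ρ·nsq x` give
`(γ − ρ)·nsq ≤ Re⟨x̄, (S + P)x⟩`. [folklore] -/
theorem reCoercive_add_of_norm_form_le {S P : Matrix n n ℂ} {γ ρ : ℝ} (hS : ∀ x, γ * nsq x ≤ (star x ⬝ᵥ S *ᵥ x).re)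
    (hP : ∀ x, ‖star x ⬝ᵥ P *ᵥ x‖ ≤ ρ * nsq x) (x : n → ℂ) : (γ - ρ) * nsq x ≤ (star x ⬝ᵥ (S + P) *ᵥ x).re := by
  rw [Matrix.add_mulVec, dotProduct_add, Complex.add_re, sub_mul]
  have h1 := hS x
  have h2 : -(ρ * nsq x) ≤ (star x ⬝ᵥ P *ᵥ x).re := by
    have := (abs_le.mp ((Complex.abs_re_le_norm _).trans (hP x))).1
    linarith
  linarith

omit [DecidableEq n] in
/-- Monotonicity of the shape in the constant. [folklore] -/
theorem reCoercive_mono {S : Matrix n n ℂ} {γ γ' : ℝ} (h : ∀ x, γ * nsq x ≤ (star x ⬝ᵥ S *ᵥ x).re) (hle : γ' ≤ γ) (x : n → ℂ) :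
    γ' * nsq x ≤ (star x ⬝ᵥ S *ᵥ x).re :=
  (mul_le_mul_of_nonneg_right hle (nsq_nonneg x)).trans (h x)

/-- `IsUnit S.det` for a `Re`-coercive matrix with `γ > 0` (`AccretiveCombesThomas.isUnit_of_reCoercive`). [folklore] -/
theorem isUnit_det_of_reCoercive {S : Matrix n n ℂ} {γ : ℝ} (hγ : 0 < γ) (h : ∀ x, γ * nsq x ≤ (star x ⬝ᵥ S *ᵥ x).re) :
    IsUnit S.det :=
  (Matrix.isUnit_iff_isUnit_det S).mp (isUnit_of_reCoercive hγ h)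

/-- **THE RESOLVENT BOUND** `‖S⁻¹u‖₂ ≤ γ⁻¹‖u‖₂` for a `Re`-coercive `S` (`γ > 0`) — Lax–Milgram in finite dimensions. [folklore] -/
theorem sqrt_nsq_inv_mulVec_le {S : Matrix n n ℂ} {γ : ℝ} (hγ : 0 < γ) (h : ∀ x, γ * nsq x ≤ (star x ⬝ᵥ S *ᵥ x).re) (u : n → ℂ) :
    Real.sqrt (nsq (S⁻¹ *ᵥ u)) ≤ γ⁻¹ * Real.sqrt (nsq u) := by
  set v := S⁻¹ *ᵥ u with hv
  have hSv : S *ᵥ v = u := by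
    rw [hv, Matrix.mulVec_mulVec, Matrix.mul_nonsing_inv _ (isUnit_det_of_reCoercive hγ h), Matrix.one_mulVec]
  have key : γ * nsq v ≤ Real.sqrt (nsq v) * Real.sqrt (nsq u) := by
    calc γ * nsq v ≤ (star v ⬝ᵥ S *ᵥ v).re := h v
      _ = (star v ⬝ᵥ u).re := by rw [hSv]
      _ ≤ ‖star v ⬝ᵥ u‖ := Complex.re_le_norm _
      _ ≤ Real.sqrt (nsq v) * Real.sqrt (nsq u) := norm_star_dotProduct_le v u
  have hs0 : 0 ≤ Real.sqrt (nsq v) := Real.sqrt_nonneg _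
  rcases eq_or_lt_of_le hs0 with hs | hs
  · rw [← hs]; exact mul_nonneg (inv_nonneg.mpr hγ.le) (Real.sqrt_nonneg _)
  · have key' : γ * (Real.sqrt (nsq v) * Real.sqrt (nsq v)) ≤ Real.sqrt (nsq v) * Real.sqrt (nsq u) := by
      rwa [sqrt_nsq_mul_self]
    have h2 : γ * Real.sqrt (nsq v) ≤ Real.sqrt (nsq u) := by nlinarith [key', hs]
    calc Real.sqrt (nsq v) = γ⁻¹ * (γ * Real.sqrt (nsq v)) := by field_simp
      _ ≤ γ⁻¹ * Real.sqrt (nsq u) := mul_le_mul_of_nonneg_left h2 (inv_nonneg.mpr hγ.le)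

/-- **ENTRY BOUND**: every entry of the inverse of a `Re`-coercive matrix (`γ > 0`) has norm at most `γ⁻¹` (complex twin of
`QGQInverse.inv_entry_le_of_coercive`). [folklore] -/
theorem inv_entry_norm_le_of_reCoercive {S : Matrix n n ℂ} {γ : ℝ} (hγ : 0 < γ) (h : ∀ x, γ * nsq x ≤ (star x ⬝ᵥ S *ᵥ x).re)
    (i j : n) : ‖S⁻¹ i j‖ ≤ γ⁻¹ := by
  have key := sqrt_nsq_inv_mulVec_le hγ h (Pi.single j (1 : ℂ))
  rw [nsq_single, Real.sqrt_one, mul_one, Matrix.mulVec_single_one] at key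
  have hij : ‖S⁻¹ i j‖ = ‖(S⁻¹.col j) i‖ := rfl
  rw [hij]
  exact (norm_le_sqrt_nsq _ i).trans key

/-- **FORM BOUND OF A RESOLVENT SANDWICH**: for `Re`-coercive `S` (`γ > 0`) and any vectors, `‖⟨ȳ, S⁻¹u⟩‖ ≤ γ⁻¹‖y‖₂‖u‖₂`. [folklore] -/
theorem norm_star_dotProduct_inv_mulVec_le {S : Matrix n n ℂ} {γ : ℝ} (hγ : 0 < γ) (h : ∀ x, γ * nsq x ≤ (star x ⬝ᵥ S *ᵥ x).re)
    (y u : n → ℂ) : ‖star y ⬝ᵥ S⁻¹ *ᵥ u‖ ≤ γ⁻¹ * (Real.sqrt (nsq y) * Real.sqrt (nsq u)) := by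
  calc ‖star y ⬝ᵥ S⁻¹ *ᵥ u‖ ≤ Real.sqrt (nsq y) * Real.sqrt (nsq (S⁻¹ *ᵥ u)) := norm_star_dotProduct_le _ _
    _ ≤ Real.sqrt (nsq y) * (γ⁻¹ * Real.sqrt (nsq u)) :=
        mul_le_mul_of_nonneg_left (sqrt_nsq_inv_mulVec_le hγ h u) (Real.sqrt_nonneg _)
    _ = γ⁻¹ * (Real.sqrt (nsq y) * Real.sqrt (nsq u)) := by ring

/-- `‖(z·diag w)v‖₂ ≤ ‖z‖·w₀·‖v‖₂` for `|w_i| ≤ w₀`, `w₀ ≥ 0`. [folklore] -/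
theorem sqrt_nsq_smul_diagonal_mulVec_le {w : n → ℝ} {w₀ : ℝ} (hw₀ : 0 ≤ w₀) (hw : ∀ i, |w i| ≤ w₀) (z : ℂ) (v : n → ℂ) :
    Real.sqrt (nsq ((z • Matrix.diagonal (fun i => (w i : ℂ))) *ᵥ v)) ≤ ‖z‖ * w₀ * Real.sqrt (nsq v) := by
  have h : nsq ((z • Matrix.diagonal (fun i => (w i : ℂ))) *ᵥ v) ≤ (‖z‖ * w₀) ^ 2 * nsq v := by
    unfold nsq
    rw [mul_sum]
    refine sum_le_sum fun i _ => ?_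
    rw [Matrix.smul_mulVec, Pi.smul_apply, Matrix.mulVec_diagonal, smul_eq_mul, norm_mul, norm_mul, Complex.norm_real, Real.norm_eq_abs]
    have h1 : ‖z‖ * (|w i| * ‖v i‖) ≤ ‖z‖ * w₀ * ‖v i‖ := by
      rw [← mul_assoc]
      exact mul_le_mul_of_nonneg_right (mul_le_mul_of_nonneg_left (hw i) (norm_nonneg z)) (norm_nonneg _)
    calc (‖z‖ * (|w i| * ‖v i‖)) ^ 2 ≤ (‖z‖ * w₀ * ‖v i‖) ^ 2 := pow_le_pow_left₀ (by positivity) h1 2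
      _ = (‖z‖ * w₀) ^ 2 * ‖v i‖ ^ 2 := by ring
  calc Real.sqrt (nsq ((z • Matrix.diagonal (fun i => (w i : ℂ))) *ᵥ v)) ≤ Real.sqrt ((‖z‖ * w₀) ^ 2 * nsq v) := Real.sqrt_le_sqrt h
    _ = ‖z‖ * w₀ * Real.sqrt (nsq v) := by rw [Real.sqrt_mul (sq_nonneg _), Real.sqrt_sq (mul_nonneg (norm_nonneg z) hw₀)]

/-! ## §2 Holomorphic matrix families: determinant, adjugate, inverse entries -/

section Holomorphic

variable {M : ℂ → Matrix n n ℂ} {z₀ : ℂ}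

/-- **The determinant of an entrywise holomorphic matrix family is holomorphic** (Leibniz expansion: a finite sum of finite products).
[folklore] -/
theorem differentiableAt_det_of_entries (hM : ∀ i j, DifferentiableAt ℂ (fun z => M z i j) z₀) :
    DifferentiableAt ℂ (fun z => (M z).det) z₀ := by
  have hfun : (fun z => (M z).det) = fun z => ∑ σ : Equiv.Perm n, ((Equiv.Perm.sign σ : ℤ) : ℂ) * ∏ i, M z (σ i) i := by
    funext z; exact Matrix.det_apply' (M z)
  rw [hfun]
  refine DifferentiableAt.fun_sum fun σ _ => ?_
  exact (DifferentiableAt.fun_finsetProd (u := univ) (f := fun i z => M z (σ i) i) fun i _ => hM (σ i) i).const_mul _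

/-- **Every adjugate entry of an entrywise holomorphic matrix family is holomorphic** (the determinant of the row-updated family).
[folklore] -/
theorem differentiableAt_adjugate_apply_of_entries (hM : ∀ i j, DifferentiableAt ℂ (fun z => M z i j) z₀) (i j : n) :
    DifferentiableAt ℂ (fun z => (M z).adjugate i j) z₀ := by
  have hfun : (fun z => (M z).adjugate i j) = fun z => ((M z).updateRow j (Pi.single i 1)).det := by
    funext z; exact Matrix.adjugate_apply (M z) i j
  rw [hfun]
  refine differentiableAt_det_of_entries (M := fun z => (M z).updateRow j (Pi.single i 1)) fun i' j' => ?_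
  by_cases hi : i' = j
  · simp only [Matrix.updateRow_apply, if_pos hi]
    exact differentiableAt_const _
  · simp only [Matrix.updateRow_apply, if_neg hi]
    exact hM i' j'

/-- **EVERY ENTRY OF THE INVERSE OF AN ENTRYWISE HOLOMORPHIC MATRIX FAMILY IS HOLOMORPHIC AT AN INVERTIBLE POINT** (Cramer's rule:
`(M z)⁻¹ = (det M z)⁻¹·adj(M z)`).  The tree's `LogDetDerivative.differentiableAt_inv_apply` is the same statement for a REAL parameter.
[folklore] -/
theorem differentiableAt_inv_apply_of_entries (hM : ∀ i j, DifferentiableAt ℂ (fun z => M z i j) z₀) (hU : IsUnit (M z₀).det)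
    (i j : n) : DifferentiableAt ℂ (fun z => (M z)⁻¹ i j) z₀ := by
  have hfun : (fun z => (M z)⁻¹ i j) = fun z => ((M z).det)⁻¹ * (M z).adjugate i j := by
    funext z
    have h := congrFun (congrFun (Matrix.inv_def (M z)) i) j
    rw [h, Matrix.smul_apply, smul_eq_mul, Ring.inverse_eq_inv']
  rw [hfun]
  exact ((differentiableAt_det_of_entries hM).inv hU.ne_zero).mul (differentiableAt_adjugate_apply_of_entries hM i j)

omit [Fintype n] [DecidableEq n] in
/-- The affine family `z ↦ A + z·W` is entrywise holomorphic. [folklore] -/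
theorem differentiableAt_affine_entry (A W : Matrix n n ℂ) (z₀ : ℂ) (i j : n) :
    DifferentiableAt ℂ (fun z : ℂ => (A + z • W) i j) z₀ := by
  simp only [Matrix.add_apply, Matrix.smul_apply, smul_eq_mul]
  exact (differentiableAt_const _).add ((differentiableAt_id).mul (differentiableAt_const _))

end Holomorphic

/-! ## §3 Reading real matrices over ℂ -/

section Casts

variable {l m p : Type*} [Fintype m]

omit [Fintype n] [DecidableEq n] in
/-- `(A·B).map ofReal = A.map ofReal · B.map ofReal`. [folklore] -/
theorem map_ofReal_mul (A : Matrix l m ℝ) (B : Matrix m p ℝ) :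
    (A * B).map Complex.ofReal = A.map Complex.ofReal * B.map Complex.ofReal := by
  ext i j
  simp only [Matrix.map_apply, Matrix.mul_apply, Complex.ofReal_sum, Complex.ofReal_mul]

omit [Fintype n] [DecidableEq n] [Fintype m] in
/-- `(A + B).map ofReal = A.map ofReal + B.map ofReal`. [folklore] -/
theorem map_ofReal_add (A B : Matrix l m ℝ) : (A + B).map Complex.ofReal = A.map Complex.ofReal + B.map Complex.ofReal := by
  ext i j
  simp only [Matrix.map_apply, Matrix.add_apply, Complex.ofReal_add]

omit [Fintype n] [DecidableEq n] [Fintype m] in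
/-- `(A − B).map ofReal = A.map ofReal − B.map ofReal`. [folklore] -/
theorem map_ofReal_sub (A B : Matrix l m ℝ) : (A - B).map Complex.ofReal = A.map Complex.ofReal - B.map Complex.ofReal := by
  ext i j
  simp only [Matrix.map_apply, Matrix.sub_apply, Complex.ofReal_sub]

omit [Fintype n] [DecidableEq n] [Fintype m] in
/-- `(r·A).map ofReal = (r : ℂ)·A.map ofReal`. [folklore] -/
theorem map_ofReal_smul (r : ℝ) (A : Matrix l m ℝ) : (r • A).map Complex.ofReal = (r : ℂ) • A.map Complex.ofReal := by
  ext i j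
  simp only [Matrix.map_apply, Matrix.smul_apply, smul_eq_mul, Complex.ofReal_mul]

omit [Fintype n] [DecidableEq n] [Fintype m] in
/-- At a real coupling `t` the affine complex family built from real data is the real affine family read over ℂ:
`A.map ofReal + (t : ℂ)·(W.map ofReal) = (A + t·W).map ofReal`. [folklore] -/
theorem affine_map_ofReal (A W : Matrix l m ℝ) (t : ℝ) :
    A.map Complex.ofReal + (t : ℂ) • W.map Complex.ofReal = (A + t • W).map Complex.ofReal := by
  rw [map_ofReal_add, map_ofReal_smul]

end Casts

/-- **The inverse of a real matrix, read over ℂ**: `(A.map ofReal)⁻¹ = A⁻¹.map ofReal` (Cramer's rule commutes with the ring map).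
[folklore] -/
theorem map_ofReal_inv (A : Matrix n n ℝ) : (A.map Complex.ofReal)⁻¹ = A⁻¹.map Complex.ofReal := by
  have hdet : (A.map Complex.ofReal).det = (A.det : ℂ) := by
    have h := RingHom.map_det Complex.ofRealHom A
    rw [RingHom.mapMatrix_apply] at h
    exact h.symm
  have hadj : (A.map Complex.ofReal).adjugate = A.adjugate.map Complex.ofReal := by
    have h := RingHom.map_adjugate Complex.ofRealHom A
    rw [RingHom.mapMatrix_apply, RingHom.mapMatrix_apply] at h
    exact h.symm
  rw [Matrix.inv_def, Matrix.inv_def, hdet, hadj, Ring.inverse_eq_inv', Ring.inverse_eq_inv']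
  ext i j
  simp only [Matrix.smul_apply, Matrix.map_apply, smul_eq_mul, Complex.ofReal_mul, Complex.ofReal_inv]

end Summit.QuantumFields.YangMills.BalabanUVNodes.N15.KingModel

end
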